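import Mathlib
import HarnessLib
import Summits.HubbardSuperconductivity.HubbardSuperconductivity.Theorems.KLProgrammeCyclicAbelSummation

/-!
# Route `KLProgramme` — ENGINE (stmt-HubbardSuperconductivity-20437 `KLRegimeEngineV17F2`): the `N`-UNIFORM MEAN BOUND on a discrete
# Fourier transform from its `L¹` mass and the `L¹` mass of its second difference (abstract `ZMod N` form of «`A` is β- and M-free»)

Cell `gate-hubbard-kl`, seat p1b g23 (registrant lineage), def-free helper `--supports stmt-HubbardSuperconductivity-20437`;
third of three (✓ `KLProgrammeFourLegCommonTimeL1`: `Θ ≤ A₁A₂A₃A₄`; ✓ `KLProgrammeCyclicAbelSummation`: cyclic Abel summation,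
`|ǧ(-j)| ≤ min(‖g‖₁, N²‖Δ²g‖₁/(16k²))`).  Here the two regimes are summed over `j ∈ ZMod N`:
* `klct_card_filter_natAbs_valMinAbs_le` — at most `2J+1` residues have `|valMinAbs| ≤ J`;
* `klct_card_fiber_natAbs_valMinAbs_le_two` — at most two residues share `|valMinAbs| = m`;
* `klct_sum_inv_sq_valMinAbs_le` — `Σ_{j : |k_j| > J} k_j⁻² ≤ 4/(J+1)` (Mathlib `sum_Ioo_inv_sq_le`);
* **`klct_sum_norm_dft_le`** — for every `J : ℕ`,
  `Σ_j |ǧ(j)| ≤ (2J+1)·‖g‖₁ + (N²/(4(J+1)))·‖Δ²g‖₁`, `‖Δ²g‖₁ = Σ_n |g n - 2g(n-1) + g(n-2)|`;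
  dividing by `N`: `A := N⁻¹Σ_j|ǧ(j)| ≤ (2J+1)/N·‖g‖₁ + N/(4(J+1))·‖Δ²g‖₁` (`klct_mean_norm_dft_le`).  For a `C²` cut-off of lattice
  width `w` (`‖g‖₁ ≍ w`, `‖Δ²g‖₁ ≍ w⁻¹`) the choice `J ≍ N/w` makes the right side `N`- and `w`-free — the k3c2 lineage's «`A ≲ const`»
  (HOME/hubbard-kl-k3c2-p2/g34/CUT-CURRENCY-DIGITS.md rev 2), whose model-side arithmetic is the instantiating seat's.
Pure finite-sum algebra; no definition, no model estimate; nothing here asserts any registered row, K3, U₀, the window, a margin or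
superconductivity in the Hubbard model.
References: BGM 2006 §2.3 (2.17) [cite: BenfattoGiulianiMastropietro2006]; `Σ_{i>k} i⁻² ≤ 2/(k+1)` [folklore].
-/

noncomputable section

namespace Summit.HubbardSuperconductivity.HubbardSuperconductivity.Theorems.KLRegimeSplit

set_option linter.dupNamespace false -- summit = problem name (single-conjunct summit), D-0017

open Finset

variable {N : ℕ} [NeZero N]

/-- At most `2J+1` residues `j : ZMod N` have `|valMinAbs j| ≤ J` (`valMinAbs` is injective into `[-J, J] ∩ ℤ`). [folklore] -/
theorem klct_card_filter_natAbs_valMinAbs_le (J : ℕ) :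
    #{j : ZMod N | j.valMinAbs.natAbs ≤ J} ≤ 2 * J + 1 := by
  calc #{j : ZMod N | j.valMinAbs.natAbs ≤ J}
      ≤ #(Finset.Icc (-(J : ℤ)) J) := by
        refine Finset.card_le_card_of_injOn (fun j => j.valMinAbs) ?_ ?_
        · intro j hj
          simp only [Finset.coe_filter, Finset.mem_univ, true_and, Set.mem_setOf_eq] at hj
          simp only [Finset.coe_Icc, Set.mem_Icc]
          have h : |j.valMinAbs| ≤ (J : ℤ) := by
            rw [← Int.natCast_natAbs]
            exact_mod_cast hj
          exact abs_le.mp h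
        · intro a _ b _ h
          exact ZMod.valMinAbs_inj.mp h
    _ = 2 * J + 1 := by
        rw [Int.card_Icc]
        have h : (J : ℤ) + 1 - -(J : ℤ) = ((2 * J + 1 : ℕ) : ℤ) := by
          push_cast
          ring
        rw [h, Int.toNat_natCast]

omit [NeZero N] in
/-- At most two residues share the value `m` of `|valMinAbs|` (namely `valMinAbs = ±m`). [folklore] -/
theorem klct_card_fiber_natAbs_valMinAbs_le_two (s : Finset (ZMod N)) (m : ℕ) :
    #{j ∈ s | j.valMinAbs.natAbs = m} ≤ 2 := by
  by_contra h
  rw [not_le] at h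
  obtain ⟨a, ha, b, hb, c, hc, hab, hac, hbc⟩ := Finset.two_lt_card.mp h
  simp only [Finset.mem_filter] at ha hb hc
  have key : ∀ x y : ZMod N, x.valMinAbs.natAbs = m → y.valMinAbs.natAbs = m → x ≠ y →
      x.valMinAbs = -y.valMinAbs := by
    intro x y hx hy hxy
    rcases Int.natAbs_eq_natAbs_iff.mp (hx.trans hy.symm) with h' | h'
    · exact absurd (ZMod.valMinAbs_inj.mp h') hxy
    · exact h'
  have h1 := key a b ha.2 hb.2 hab
  have h2 := key a c ha.2 hc.2 hac
  exact hbc (ZMod.valMinAbs_inj.mp (by linarith))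

/-- `Σ_{j : |k_j| > J} k_j⁻² ≤ 4/(J+1)` over `ZMod N`, `k_j = valMinAbs j` (two residues per value of `|k|`, then
`Σ_{i > J} i⁻² ≤ 2/(J+1)`). [folklore] -/
theorem klct_sum_inv_sq_valMinAbs_le (J : ℕ) :
    ∑ j ∈ ({j : ZMod N | J < j.valMinAbs.natAbs} : Finset (ZMod N)), ((j.valMinAbs : ℝ) ^ 2)⁻¹ ≤ 4 / (J + 1) := by
  set B : Finset (ZMod N) := {j : ZMod N | J < j.valMinAbs.natAbs} with hB
  -- read the summand through `m = |k_j|`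
  have hread : ∀ j : ZMod N, ((j.valMinAbs : ℝ) ^ 2)⁻¹ = (((j.valMinAbs.natAbs : ℕ) : ℝ) ^ 2)⁻¹ := by
    intro j
    rw [Nat.cast_natAbs, Int.cast_abs, sq_abs]
  simp_rw [hread]
  -- fibre decomposition over `m ∈ Ioo J (N+1)`
  have hmaps : ∀ j ∈ B, j.valMinAbs.natAbs ∈ Finset.Ioo J (N + 1) := by
    intro j hj
    rw [hB, Finset.mem_filter] at hj
    rw [Finset.mem_Ioo]
    exact ⟨hj.2, lt_of_le_of_lt (ZMod.natAbs_valMinAbs_le j) (lt_of_le_of_lt (Nat.div_le_self N 2) (Nat.lt_succ_self N))⟩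
  rw [← Finset.sum_fiberwise_of_maps_to' hmaps (fun m : ℕ => (((m : ℕ) : ℝ) ^ 2)⁻¹)]
  calc ∑ m ∈ Finset.Ioo J (N + 1), ∑ j ∈ B with j.valMinAbs.natAbs = m, (((m : ℕ) : ℝ) ^ 2)⁻¹
      ≤ ∑ m ∈ Finset.Ioo J (N + 1), 2 * (((m : ℕ) : ℝ) ^ 2)⁻¹ := by
        refine Finset.sum_le_sum fun m _ => ?_
        rw [Finset.sum_const, nsmul_eq_mul]
        refine mul_le_mul_of_nonneg_right ?_ (by positivity)
        exact_mod_cast klct_card_fiber_natAbs_valMinAbs_le_two B m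
    _ = 2 * ∑ m ∈ Finset.Ioo J (N + 1), (((m : ℕ) : ℝ) ^ 2)⁻¹ := by rw [Finset.mul_sum]
    _ ≤ 2 * (2 / (J + 1)) := by
        refine mul_le_mul_of_nonneg_left ?_ (by norm_num)
        exact sum_Ioo_inv_sq_le J (N + 1)
    _ = 4 / (J + 1) := by ring

/-- **SUMMED TWO-REGIME BOUND.** For `g : ZMod N → ℂ`, `ǧ = ZMod.dft g` and every `J : ℕ`:
`Σ_j |ǧ(j)| ≤ (2J+1)·Σ_n|g n| + (N²/(4(J+1)))·Σ_n|g n - 2g(n-1) + g(n-2)|`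
(near modes `|k_j| ≤ J`: the trivial bound; far modes: second-difference bound ÷ Jordan² — cf. `klct_norm_dft_le_secondDiff_div_sq` — and `Σ k⁻² ≤ 4/(J+1)`).
[cite: BenfattoGiulianiMastropietro2006, §2.3 (2.17)] -/
theorem klct_sum_norm_dft_le (g : ZMod N → ℂ) (J : ℕ) :
    ∑ j : ZMod N, ‖ZMod.dft g j‖ ≤
      (2 * J + 1) * (∑ n : ZMod N, ‖g n‖) +
        (N : ℝ) ^ 2 / (4 * (J + 1)) * ∑ n : ZMod N, ‖g n - 2 * g (n - 1) + g (n - 2)‖ := by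
  set G : ℝ := ∑ n : ZMod N, ‖g n‖ with hG
  set D : ℝ := ∑ n : ZMod N, ‖g n - 2 * g (n - 1) + g (n - 2)‖ with hD
  have hG0 : 0 ≤ G := Finset.sum_nonneg fun n _ => norm_nonneg _
  have hD0 : 0 ≤ D := Finset.sum_nonneg fun n _ => norm_nonneg _
  -- re-index `j ↦ -j` so that every term is `|ǧ(-j)|`
  have hneg : ∑ j : ZMod N, ‖ZMod.dft g j‖ = ∑ j : ZMod N, ‖ZMod.dft g (-j)‖ :=
    (Fintype.sum_equiv (Equiv.neg (ZMod N)) (fun j => ‖ZMod.dft g (-j)‖) (fun u => ‖ZMod.dft g u‖)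
      (fun _ => rfl)).symm
  rw [hneg, ← Finset.sum_filter_add_sum_filter_not Finset.univ (fun j : ZMod N => j.valMinAbs.natAbs ≤ J)]
  refine add_le_add ?_ ?_
  · -- near modes: at most `2J+1` terms, each `≤ G`
    calc ∑ j ∈ Finset.univ.filter (fun j : ZMod N => j.valMinAbs.natAbs ≤ J), ‖ZMod.dft g (-j)‖
        ≤ ∑ j ∈ Finset.univ.filter (fun j : ZMod N => j.valMinAbs.natAbs ≤ J), G :=
          Finset.sum_le_sum fun j _ => klct_norm_dft_le_sum_norm g (-j)
      _ = #{j : ZMod N | j.valMinAbs.natAbs ≤ J} * G := by rw [Finset.sum_const, nsmul_eq_mul]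
      _ ≤ (2 * J + 1) * G := by
          refine mul_le_mul_of_nonneg_right ?_ hG0
          exact_mod_cast klct_card_filter_natAbs_valMinAbs_le (N := N) J
  · -- far modes: `|ǧ(-j)| ≤ N²/(16 k²)·D`, then `Σ k⁻² ≤ 4/(J+1)`
    have hfar : ∀ j ∈ Finset.univ.filter (fun j : ZMod N => ¬ j.valMinAbs.natAbs ≤ J),
        ‖ZMod.dft g (-j)‖ ≤ (N : ℝ) ^ 2 / 16 * D * ((j.valMinAbs : ℝ) ^ 2)⁻¹ := by
      intro j hj
      rw [Finset.mem_filter] at hj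
      have hj0 : j ≠ 0 := by
        intro h0
        apply hj.2
        rw [h0, ZMod.valMinAbs_zero]
        exact Nat.zero_le J
      -- pointwise: second-difference bound ÷ Jordan's inequality squared (as in `klct_norm_dft_le_secondDiff_div_sq`)
      have hk : (j.valMinAbs : ℝ) ≠ 0 := by
        exact_mod_cast fun h => hj0 ((ZMod.valMinAbs_eq_zero j).mp h)
      have hN : (0 : ℝ) < N := Nat.cast_pos.mpr (NeZero.pos N)
      have hpos : 0 < 4 * |(j.valMinAbs : ℝ)| / N := by positivity
      have hlow : (4 * |(j.valMinAbs : ℝ)| / N) ^ 2 ≤ ‖1 - (ZMod.stdAddChar j : ℂ)‖ ^ 2 :=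
        pow_le_pow_left₀ hpos.le (klct_jordan_one_sub_stdAddChar j) 2
      have hc : 0 < ‖1 - (ZMod.stdAddChar j : ℂ)‖ ^ 2 := lt_of_lt_of_le (pow_pos hpos 2) hlow
      have hmain := klct_normSq_oneSub_mul_norm_dft_le g j
      rw [← hD] at hmain
      calc ‖ZMod.dft g (-j)‖
          ≤ D / ‖1 - (ZMod.stdAddChar j : ℂ)‖ ^ 2 := by
            rw [le_div_iff₀ hc, mul_comm]
            exact hmain
        _ ≤ D / (4 * |(j.valMinAbs : ℝ)| / N) ^ 2 := div_le_div_of_nonneg_left hD0 (pow_pos hpos 2) hlow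
        _ = (N : ℝ) ^ 2 / 16 * D * ((j.valMinAbs : ℝ) ^ 2)⁻¹ := by
            rw [div_pow, mul_pow, sq_abs]
            field_simp
            ring
    have hset : Finset.univ.filter (fun j : ZMod N => ¬ j.valMinAbs.natAbs ≤ J) =
        ({j : ZMod N | J < j.valMinAbs.natAbs} : Finset (ZMod N)) := by
      ext j
      simp only [Finset.mem_filter, Finset.mem_univ, true_and, not_le]
    calc ∑ j ∈ Finset.univ.filter (fun j : ZMod N => ¬ j.valMinAbs.natAbs ≤ J), ‖ZMod.dft g (-j)‖
        ≤ ∑ j ∈ Finset.univ.filter (fun j : ZMod N => ¬ j.valMinAbs.natAbs ≤ J),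
            (N : ℝ) ^ 2 / 16 * D * ((j.valMinAbs : ℝ) ^ 2)⁻¹ := Finset.sum_le_sum hfar
      _ = (N : ℝ) ^ 2 / 16 * D *
            ∑ j ∈ ({j : ZMod N | J < j.valMinAbs.natAbs} : Finset (ZMod N)), ((j.valMinAbs : ℝ) ^ 2)⁻¹ := by
          rw [← Finset.mul_sum, hset]
      _ ≤ (N : ℝ) ^ 2 / 16 * D * (4 / (J + 1)) :=
          mul_le_mul_of_nonneg_left (klct_sum_inv_sq_valMinAbs_le J) (by positivity)
      _ = (N : ℝ) ^ 2 / (4 * (J + 1)) * D := by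
          field_simp
          ring

/-- **The mean form**: `A := N⁻¹ Σ_j |ǧ(j)| ≤ (2J+1)/N · ‖g‖₁ + N/(4(J+1)) · ‖Δ²g‖₁` for every `J : ℕ`.
[cite: BenfattoGiulianiMastropietro2006, §2.3 (2.17)] -/
theorem klct_mean_norm_dft_le (g : ZMod N → ℂ) (J : ℕ) :
    (N : ℝ)⁻¹ * ∑ j : ZMod N, ‖ZMod.dft g j‖ ≤
      (2 * J + 1) / N * (∑ n : ZMod N, ‖g n‖) +
        (N : ℝ) / (4 * (J + 1)) * ∑ n : ZMod N, ‖g n - 2 * g (n - 1) + g (n - 2)‖ := by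
  have hN : (0 : ℝ) < N := Nat.cast_pos.mpr (NeZero.pos N)
  have h := mul_le_mul_of_nonneg_left (klct_sum_norm_dft_le g J) (inv_nonneg.mpr hN.le)
  refine h.trans (le_of_eq ?_)
  field_simp

end Summit.HubbardSuperconductivity.HubbardSuperconductivity.Theorems.KLRegimeSplit

end
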